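import Summits.MatrixMultiplication.OmegaCensus.STPP222CubeSearch
import Summits.MatrixMultiplication.OmegaCensus.STPP222CubeNone_2_4_3ElB

/-!
# ω-census, `(2,2,2)³` is infeasible in `ZMod 2 × (ZMod 4 × ZMod 3)` — kernel search, part 5 of 5

HONEST FRAMING (pub-omega census; verbatim): lottery ticket; floor = certified bounds/negative ranges.
Census STRUCTURE bookkeeping (question Q7, row `k = 3`, lower half `n₃ ≥ 32`), not progress on `ω`.

Chunks 57–59 of the kernel mask search over the canonical start list of `ZMod 2 × (ZMod 4 × ZMod 3)` (padded codes); assembled in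
`STPP222CubeNone_2_4_3.lean`.  Data generated by ENG2 gen 18/19's `prodgen3.py`; predicted kernel time 56 s.

References: H. Cohn, R. Kleinberg, B. Szegedy, C. Umans, FOCS 2005 (arXiv:math/0511460), Def. 5.1.
-/

set_option Elab.async false  -- many kernel pieces: elaborate sequentially (memory)

namespace Summit.MatrixMultiplication.OmegaCensus

namespace STPP222CubeNeg

/-- Start-list chunk 57 (2 entries; 59928 clause evaluations ≈ 21 s predicted). -/
def P2_4_3.ch57 : List (ℕ × ℕ × ℕ × List ℕ) :=
  [(128, 4096, 4097, el2_4_3b), (128, 4096, 4225, el2_4_3b)]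

/-- Kernel search over chunk 57. -/
theorem P2_4_3.s57 : searchB3 E2_4_3b.A el2_4_3b P2_4_3.ch57 = true := by
  decide +kernel

/-- Start-list chunk 58 (2 entries; 45348 clause evaluations ≈ 16 s predicted). -/
def P2_4_3.ch58 : List (ℕ × ℕ × ℕ × List ℕ) :=
  [(129, 4096, 4097, el2_4_3b), (129, 4096, 4224, el2_4_3b)]

/-- Kernel search over chunk 58. -/
theorem P2_4_3.s58 : searchB3 E2_4_3b.A el2_4_3b P2_4_3.ch58 = true := by
  decide +kernel

/-- Start-list chunk 59 (2 entries; 54048 clause evaluations ≈ 19 s predicted). -/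
def P2_4_3.ch59 : List (ℕ × ℕ × ℕ × List ℕ) :=
  [(4096, 4097, 4224, el2_4_3b), (4096, 4097, 4225, el2_4_3b)]

/-- Kernel search over chunk 59. -/
theorem P2_4_3.s59 : searchB3 E2_4_3b.A el2_4_3b P2_4_3.ch59 = true := by
  decide +kernel

end STPP222CubeNeg

end Summit.MatrixMultiplication.OmegaCensus
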